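import Summits.AtomisticToContinuum.HydrodynamicLimit.Theorems.LocalSecondLaw.Negative.LinearMajorant

/-!
# Energy fluctuations of the mollified fields are small in `L¹`, uniformly in the field point

Tightness programme, step D2, for the crux `JParityClosure.LocalSecondLaw` (stmt-AtomisticToContinuum-13081;
standing disprover's `Cruxes/LocalSecondLaw/Disproof.lean`).  Under the homogeneous unit local Gibbs law the
fluctuation `W = e_r(x₀) - (3/2)ρ_r(x₀) = (N+1)⁻¹ ∑ᵢ b_r(xᵢ,x₀)(|vᵢ|²/2 - 3/2)` is a velocity average of the
centred kinetic energy (`kinC_sub_rhoC_eq`; centred / `L²` / variance `≤ K/2` under `N(0,I₃)`: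
`energyObs_centred`, `energyObs_variance_le` from the tree's Gaussian moment lemmas), so the tree's conditional
Chebyshev bound `localGibbsMeasure_velFluct_le` gives the tail `G_N{t ≤ |W|} ≤ c_N/t²`,
`c_N = (3/(πr³))² (K/2)/(N+1)` (`localGibbsLaw_fluct_tail_le`), and the layer-cake formula with
`∫_δ^∞ c_N t⁻² dt = c_N/δ` (`integral_Ioi_rpow_of_lt`) yields `E_N|W| ≤ δ + c_N/δ` for every `δ > 0`
(`lintegral_fluct_le`), uniformly in `x₀`; `c_N → 0` (`tendsto_fluctConst`).  refuter-cdisprove-stmt-AtomisticToContinuum-13081-0.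
-/

noncomputable section

namespace Summit.AtomisticToContinuum.HydrodynamicLimit.Theorems.LocalSecondLawNegative

open MeasureTheory Filter Set Topology
open scoped ENNReal
open Literature.MathematicalPhysics.KineticTheory Literature.Analysis.FluidPDE

variable {N : ℕ}

/-- The centred kinetic energy `Y(v) = |v|²/2 - 3/2` under `N(0, I₃)`: measurable, centred, `L²`,
variance `≤ K/2` (`K = gaussFourthMomentConst (Fin 3)`). [folklore] -/
theorem energyObs_centred :
    ∫ v, (‖v‖ ^ 2 / 2 - 3 / 2) ∂gaussMeasure (0 : V3) 1 = 0 := by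
  have h := integral_energy_gaussMeasure (ι := Fin 3) (0 : V3) (θ := 1) one_pos
  have hfun : (fun v : V3 => ‖v‖ ^ 2 / 2 - ‖(0 : V3)‖ ^ 2 / 2 - (Fintype.card (Fin 3) : ℝ) * 1 / 2) =
      fun v => ‖v‖ ^ 2 / 2 - 3 / 2 := by
    funext v; norm_num
  rw [hfun] at h
  exact h

/-- Variance bound of the centred kinetic energy under `N(0, I₃)`. [folklore] -/
theorem energyObs_variance_le :
    ProbabilityTheory.variance (fun v : V3 => ‖v‖ ^ 2 / 2 - 3 / 2) (gaussMeasure (0 : V3) 1) ≤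
      1 / 2 * gaussFourthMomentConst (Fin 3) := by
  have hm : AEMeasurable (fun v : V3 => ‖v‖ ^ 2 / 2 - 3 / 2) (gaussMeasure (0 : V3) 1) := by
    fun_prop
  rw [ProbabilityTheory.variance_eq_integral hm, energyObs_centred]
  have h := integral_energy_sq_gaussMeasure_le (ι := Fin 3) (0 : V3) (θ := 1) one_pos
  have hfun : (fun v : V3 => (‖v‖ ^ 2 / 2 - ‖(0 : V3)‖ ^ 2 / 2 - (Fintype.card (Fin 3) : ℝ) * 1 / 2) ^ 2) =
      fun v => (‖v‖ ^ 2 / 2 - 3 / 2 - 0) ^ 2 := by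
    funext v; norm_num
  rw [hfun] at h
  simpa using h

/-- The fluctuation observable `W = e_r - (3/2)ρ_r` as the velocity average
`(N+1)⁻¹ ∑ᵢ b_r(xᵢ, x₀) (|vᵢ|²/2 - 3/2)`. [folklore] -/
theorem kinC_sub_rhoC_eq (r : ℝ) (w : Config (N + 1) (Fin 3) T3) (x₀ : T3) :
    kinC r w x₀ - 3 / 2 * rhoC r w x₀ =
      ((N + 1 : ℕ) : ℝ)⁻¹ * ∑ i, cone r (w i).1 x₀ * (‖(w i).2‖ ^ 2 / 2 - 3 / 2) := by
  rw [kinC_eq_sum]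
  unfold rhoC
  rw [integral_empiricalMeasure, ← mul_assoc, mul_comm (3 / 2 : ℝ), mul_assoc, ← mul_sub,
    Finset.mul_sum, ← Finset.sum_sub_distrib]
  congr 1
  refine Finset.sum_congr rfl fun i _ => ?_
  ring

/-- The cone kernel is bounded by `3/(πr³)`. [folklore] -/
theorem cone_le_const {r : ℝ} (hr : 0 < r) (y x₀ : T3) : cone r y x₀ ≤ 3 / (Real.pi * r ^ 3) := by
  unfold cone
  refine mul_le_of_le_one_right (by positivity) (max_le ?_ zero_le_one)
  have : 0 ≤ Torus.euclidDist y x₀ / r := by rw [Torus.euclidDist_eq]; positivity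
  linarith

/-- **Chebyshev tail of the energy fluctuation, uniformly in the field point**:
`G_N {t ≤ |e_r - (3/2)ρ_r|(x₀)} ≤ C_r² (K/2) / ((N+1) t²)`, `C_r = 3/(πr³)` (conditionally on the
positions the velocities are independent Maxwellians: `localGibbsMeasure_velFluct_le`). [folklore] -/
theorem localGibbsLaw_fluct_tail_le {σ r : ℝ} (hr : 0 < r) (hσ : σ ≤ 1 / 2) (N : ℕ)
    (Φ : HardSphereFlow (Torus.geometry (Fin 3)) (hsDiameter σ N) (N + 1)) (x₀ : T3)
    {t : ℝ} (ht : 0 < t) :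
    localGibbsLaw σ (fun _ => 1) (fun _ => 0) (fun _ => 1) N Φ
        {w | t ≤ |kinC r w x₀ - 3 / 2 * rhoC r w x₀|} ≤
      ENNReal.ofReal ((3 / (Real.pi * r ^ 3)) ^ 2 * (1 / 2 * gaussFourthMomentConst (Fin 3)) /
        ((N + 1 : ℕ) * t ^ 2)) := by
  have hc1 : Continuous (fun _ : T3 => (1 : ℝ)) := continuous_const
  have hc0 : Continuous (fun _ : T3 => (0 : V3)) := continuous_const
  haveI := isProbabilityMeasure_localGibbsMeasure (u₀ := fun _ => (0 : V3)) hc1 hc1 hc0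
    (fun _ => one_pos) (fun _ => one_pos) hσ N
  rw [localGibbsLaw_eq]
  have hset : {w : Config (N + 1) (Fin 3) T3 | t ≤ |kinC r w x₀ - 3 / 2 * rhoC r w x₀|} =
      {w | t ≤ |((N + 1 : ℕ) : ℝ)⁻¹ * ∑ i, (fun y => cone r y x₀) (w i).1 *
        (fun (_ : T3) (v : V3) => ‖v‖ ^ 2 / 2 - 3 / 2) (w i).1 (w i).2|} := by
    ext w; rw [Set.mem_setOf_eq, Set.mem_setOf_eq, kinC_sub_rhoC_eq]
  rw [hset]
  refine localGibbsMeasure_velFluct_le hc1 hc1 hc0 (fun _ => zero_le_one) (fun _ => one_pos) σ N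
    (Y := fun (_ : T3) (v : V3) => ‖v‖ ^ 2 / 2 - 3 / 2) (by fun_prop)
    (fun _ => memLp_energy_gaussMeasure (0 : V3) 1 (3 / 2)) (fun _ => energyObs_centred)
    (fun _ => energyObs_variance_le) (continuous_cone_comp r continuous_id continuous_const)
    (fun y => ?_) ht
  rw [abs_of_nonneg (cone_nonneg hr _ _)]
  exact cone_le_const hr _ _

/-- The fluctuation constant `c_N = C_r² (K/2) / (N+1)`. [folklore] -/
def fluctConst (r : ℝ) (N : ℕ) : ℝ :=
  (3 / (Real.pi * r ^ 3)) ^ 2 * (1 / 2 * gaussFourthMomentConst (Fin 3)) / ((N + 1 : ℕ) : ℝ)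

/-- `c_N ≥ 0`. [folklore] -/
theorem fluctConst_nonneg (r : ℝ) (N : ℕ) : 0 ≤ fluctConst r N := by
  unfold fluctConst
  have := gaussFourthMomentConst_nonneg (ι := Fin 3)
  positivity

/-- `c_N → 0`. [folklore] -/
theorem tendsto_fluctConst (r : ℝ) : Tendsto (fun N => fluctConst r N) atTop (𝓝 0) := by
  have h : Tendsto (fun N : ℕ => ((N + 1 : ℕ) : ℝ)⁻¹) atTop (𝓝 0) := by
    have h1 : Tendsto (fun N : ℕ => ((N : ℝ) + 1)⁻¹) atTop (𝓝 0) := by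
      simpa only [one_div] using tendsto_one_div_add_atTop_nhds_zero_nat (𝕜 := ℝ)
    refine h1.congr fun N => ?_
    push_cast
    rfl
  have h2 := h.const_mul ((3 / (Real.pi * r ^ 3)) ^ 2 * (1 / 2 * gaussFourthMomentConst (Fin 3)))
  rw [mul_zero] at h2
  refine h2.congr fun N => ?_
  unfold fluctConst
  exact (div_eq_mul_inv _ _).symm

/-- The fluctuation observable is continuous (hence measurable) in the configuration. [folklore] -/
theorem continuous_fluct (r : ℝ) (x₀ : T3) :
    Continuous fun w : Config (N + 1) (Fin 3) T3 => |kinC r w x₀ - 3 / 2 * rhoC r w x₀| := by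
  have hk : Continuous fun w : Config (N + 1) (Fin 3) T3 => kinC r w x₀ := by
    have h := (continuous_kinC_uncurry (N := N) r).comp (Continuous.prodMk_left x₀)
    simpa only [Function.comp_def] using h
  have hρ : Continuous fun w : Config (N + 1) (Fin 3) T3 => rhoC r w x₀ := by
    have h := (continuous_rhoC_uncurry (N := N) r).comp (Continuous.prodMk_left x₀)
    simpa only [Function.comp_def] using h
  exact (hk.sub (continuous_const.mul hρ)).abs

/-- **`L¹` smallness of the energy fluctuation, uniformly in the field point**: for every `δ > 0`,
`E_N |e_r - (3/2)ρ_r|(x₀) ≤ δ + c_N/δ` (layer cake: the tail is `≤ 1` on `(0, δ]` and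
`≤ c_N/t²` beyond, `∫_δ^∞ c_N t⁻² dt = c_N/δ`). [folklore] -/
theorem lintegral_fluct_le {σ r : ℝ} (hr : 0 < r) (hσ : σ ≤ 1 / 2) (N : ℕ)
    (Φ : HardSphereFlow (Torus.geometry (Fin 3)) (hsDiameter σ N) (N + 1)) (x₀ : T3)
    {δ : ℝ} (hδ : 0 < δ) :
    ∫⁻ w, ENNReal.ofReal |kinC r w x₀ - 3 / 2 * rhoC r w x₀|
        ∂(localGibbsLaw σ (fun _ => 1) (fun _ => 0) (fun _ => 1) N Φ) ≤
      ENNReal.ofReal δ + ENNReal.ofReal (fluctConst r N / δ) := by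
  set LG := localGibbsLaw σ (fun _ => 1) (fun _ => 0) (fun _ => 1) N Φ with hLG
  haveI : IsProbabilityMeasure LG :=
    isProbabilityMeasure_localGibbsLaw continuous_const continuous_const continuous_const
      (fun _ => one_pos) (fun _ => one_pos) hσ N Φ
  rw [lintegral_eq_lintegral_meas_lt LG (ae_of_all _ fun w => abs_nonneg _)
    (continuous_fluct r x₀).measurable.aemeasurable, ← Set.Ioc_union_Ioi_eq_Ioi hδ.le,
    lintegral_union measurableSet_Ioi
      (Set.disjoint_left.2 fun t ht ht' => not_lt.2 ht.2 ht')]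
  refine add_le_add ?_ ?_
  · calc ∫⁻ t in Set.Ioc 0 δ, LG {w | t < |kinC r w x₀ - 3 / 2 * rhoC r w x₀|}
        ≤ ∫⁻ _ in Set.Ioc 0 δ, 1 := lintegral_mono fun t => prob_le_one
      _ = ENNReal.ofReal δ := by
          rw [lintegral_one, Measure.restrict_apply_univ, Real.volume_Ioc, sub_zero]
  · have htail : ∀ t ∈ Set.Ioi δ, LG {w | t < |kinC r w x₀ - 3 / 2 * rhoC r w x₀|} ≤
        ENNReal.ofReal (fluctConst r N * t ^ (-2 : ℝ)) := by
      intro t ht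
      have ht0 : 0 < t := hδ.trans ht
      refine (measure_mono fun w (hw : t < _) => hw.le).trans
        ((localGibbsLaw_fluct_tail_le hr hσ N Φ x₀ ht0).trans (le_of_eq ?_))
      congr 1
      unfold fluctConst
      rw [Real.rpow_neg ht0.le, Real.rpow_two]
      field_simp
    calc ∫⁻ t in Set.Ioi δ, LG {w | t < |kinC r w x₀ - 3 / 2 * rhoC r w x₀|}
        ≤ ∫⁻ t in Set.Ioi δ, ENNReal.ofReal (fluctConst r N * t ^ (-2 : ℝ)) :=
          setLIntegral_mono' measurableSet_Ioi htail
      _ = ENNReal.ofReal (∫ t in Set.Ioi δ, fluctConst r N * t ^ (-2 : ℝ)) := by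
          rw [← ofReal_integral_eq_lintegral_ofReal]
          · exact ((integrableOn_Ioi_rpow_of_lt (by norm_num) hδ).const_mul _)
          · refine ae_restrict_of_forall_mem measurableSet_Ioi fun t ht => ?_
            have ht0 : 0 < t := hδ.trans ht
            exact mul_nonneg (fluctConst_nonneg r N) (Real.rpow_nonneg ht0.le _)
      _ = ENNReal.ofReal (fluctConst r N / δ) := by
          rw [integral_const_mul, integral_Ioi_rpow_of_lt (by norm_num) hδ]
          congr 1
          rw [show (-2 : ℝ) + 1 = -1 by norm_num, Real.rpow_neg_one]
          field_simp


end Summit.AtomisticToContinuum.HydrodynamicLimit.Theorems.LocalSecondLawNegative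

end
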